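import Literature.NumberTheory.NumberFields.QuadraticSqrtTwoClassNumberDvdFourCertificate
import HarnessLib

/-!
# `e₁ = 2` EXACTLY: the order-four class of the ORDER-FOUR CERTIFICATE is NOT A SQUARE when its split prime `q₀` has genus bit `−1`
# (`q₀ ≡ ±3 (mod 𝔭₁³)`); hence — `#(Cl_L/Cl_L²) ≤ 2` — `8 ∤ h(K(√2))` and `ord₂ h(K(√2)) = 2`

Topic `NumberTheory/NumberFields` (namespace = path).  THEOREM-ONLY file (no definition, no named fact, no instance, no `sorry`), written by the
prover seat `bsd-line-att-p4` g40 (cell `bsd-f1-sign2`, route `AlignedTransportAtTwo`; `--supports` stmt-BirchSwinnertonDyer-22298, closes nothing).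
Sequel of this seat's `QuadraticSqrtTwoClassNumberDvdFourCertificate` (`4 ∣ h_L` from the order-four certificate) using the elementary half of
genus theory from att-p3 g43's `QuadraticSqrtTwoClassNumberNotDvdFour` (`intNorm_ne_unit_mul_sq_mul_pow`: the dyadic genus character kills
`w·b²·πⁿ`, `n` odd, `π ≡ ±3 (mod 𝔭₁³)`): the UPPER bound `ord₂ h_L ≤ 2`.

## The statements

* ★ `not_eight_dvd_natCard_of_not_mem_range_sq` (finite abelian groups): `#(G/G²) ≤ 2`, `c⁴ = 1`, `c ∉ G²` ⟹ `8 ∤ #G` (index chain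
  `G ⊋ G² ⊇ G⁴ = G⁸`: squaring is a bijection of `G⁴`, so `#G⁴` is odd); `padicValNat_two_natCard_eq_two_of_not_mem_range_sq` (`+ 4 ∣ #G ⟹ ord₂ #G = 2`).
* `intNorm_algebraMap_eq_sq` (`N_{L/K}(β) = β²`), `relNorm_eq_span_of_orderFourCert` (`𝔅² = (w,b²)`, `(w,b²)² = (w)`, `N(w) = u q₀⁴` ⟹ `N(𝔅) = (q₀)`).
* ★★ `forall_sq_ne_mk0_of_relNorm_eq_of_genusBit` — `L/K` Galois quadratic, `s² = 2 ∉ K²`, `h_K` odd, `𝔭₁` with residue field `𝔽₂` and `2 ∈ 𝔭₁ ∖ 𝔭₁²`,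
  all units `≡ ±1 (mod 𝔭₁³)`, `N_{L/K}(I) = (q₀)` with `q₀ ≡ ±3 (mod 𝔭₁³)` ⟹ `[I]` is not a square in `Cl(L)` (if `(x)𝔅² = (y)I` then
  `N(x^h β y^h) = u⁻¹ (N(y)^h)² q₀^h` with `N(𝔅)^h = (β)`, `h = h_K` odd — impossible).
* ★★ `padicValNat_two_card_classGroup_eq_two_of_genusBit` — the above + `#(Cl_L/Cl_L²) ≤ 2` + `4 ∣ h_L` + the certificate ideal identities ⟹
  `ord₂ h_L = 2`.

HONEST SCOPE: classical genus theory (Gras IV.4, Rédei–Reichardt: the `8`-rank needs one more character value) in its elementary half plus finite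
group counting; nothing specific to any summit; BSD is not advanced by this file.  USE (cell bsd-f1-sign2, crux C2, u7 sub-cell): at every `e₁ ≥ 2`
seed of the census (`12163, 14539, 13971, 4307, 1187, 13547`) the order-four prime `(q₀, s − t)` has `σ₁(q₀) ≡ ±3 (mod 8)`, so `e₁ = 2` EXACTLY.

References: [Gras2003] IV.4; [Serre1973CourseArithmetic] Ch. III §1.2 Thm. 1; [NeukirchANT1999] Ch. I §2 Prop. (2.6), §3, §7 Thm. (7.4), Ch. III §1 (1.6);
[Cohen1993] §6.5.
-/

set_option autoImplicit false

noncomputable section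

open NumberField NumberField.Units Module
open scoped nonZeroDivisors

namespace Literature.NumberTheory.NumberFields

/-! ## §1 Finite abelian groups: `#(G/G²) ≤ 2`, `c⁴ = 1`, `c ∉ G²` ⟹ `8 ∤ #G` -/

section Group

variable {G : Type*} [CommGroup G] [Finite G]

/-- In a type with at most two elements, every element is one of two given distinct ones. [folklore] -/
private theorem eq_or_eq_of_natCard_le_two {α : Type*} [Finite α] (h : Nat.card α ≤ 2) {a b : α} (hab : a ≠ b) (x : α) :
    x = a ∨ x = b := by
  by_contra hx
  rw [not_or] at hx
  obtain ⟨hxa, hxb⟩ := hx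
  have hinj : Function.Injective (![a, b, x] : Fin 3 → α) := by
    intro i j hij
    fin_cases i <;> fin_cases j <;> simp_all [eq_comm]
  have h3 := Nat.card_le_card_of_injective _ hinj
  simp only [Nat.card_eq_fintype_card, Fintype.card_fin] at h3
  omega

/-- A type all of whose elements are `a` or `b` has at most two elements. [folklore] -/
private theorem natCard_le_two_of_forall_eq_or_eq {α : Type*} [Finite α] {a b : α} (h : ∀ x : α, x = a ∨ x = b) :
    Nat.card α ≤ 2 := by
  have hsurj : Function.Surjective (fun t : Bool => if t then a else b) := by
    intro x
    rcases h x with rfl | rfl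
    · exact ⟨true, rfl⟩
    · exact ⟨false, rfl⟩
  have := Nat.card_le_card_of_surjective _ hsurj
  simpa using this

omit [Finite G] in
/-- **Coset dichotomy**: if `#(G/H) ≤ 2` and `c ∉ H` then every `g` lies in `H` or in `cH`. [folklore] -/
private theorem mem_or_inv_mul_mem_of_natCard_quotient_le_two (H : Subgroup G) [Finite (G ⧸ H)] (hG : Nat.card (G ⧸ H) ≤ 2)
    {c : G} (hc : c ∉ H) (g : G) : g ∈ H ∨ c⁻¹ * g ∈ H := by
  have hne : (QuotientGroup.mk 1 : G ⧸ H) ≠ QuotientGroup.mk c := by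
    intro h
    rw [QuotientGroup.eq, inv_one, one_mul] at h
    exact hc h
  rcases eq_or_eq_of_natCard_le_two hG hne (QuotientGroup.mk g : G ⧸ H) with h | h
  · left
    have := QuotientGroup.eq.mp h.symm
    rwa [inv_one, one_mul] at this
  · right
    exact QuotientGroup.eq.mp h.symm

/-- ★ **`#(G/G²) ≤ 2`, `c⁴ = 1`, `c ∉ G²` ⟹ `8 ∤ #G`** for a finite abelian group.  With `H = G²`, `H₂ = G⁴`: `G = H ∪ cH` gives `H = H₂ ∪ c²H₂`
(index `≤ 2`) and then `H₂ = G⁸ ∪ c⁴G⁸ = G⁸`, so squaring is a bijection of `H₂` and `#H₂` is odd (Cauchy); hence `#G = #(G/H)·#(H/H₂)·#H₂` has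
`2`-adic valuation at most `2`.  (In `ℤ/2^e`, `e ≥ 3`, every element of order dividing `4` is a square; structure of finite abelian groups.)
[cite: Cohen1993, §4.1 (finite abelian groups: Smith normal form / cyclic `p`-parts)] [cite: NeukirchANT1999, Ch. I §3 (the class group is a finite abelian group)] -/
theorem not_eight_dvd_natCard_of_not_mem_range_sq (hG : Nat.card (G ⧸ (powMonoidHom 2 : G →* G).range) ≤ 2)
    {c : G} (hc4 : c ^ 4 = 1) (hc : c ∉ (powMonoidHom 2 : G →* G).range) : ¬ 8 ∣ Nat.card G := by
  classical
  haveI : Fact (Nat.Prime 2) := ⟨Nat.prime_two⟩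
  set φ : G →* G := powMonoidHom 2 with hφ
  set H : Subgroup G := φ.range with hH
  set H₂ : Subgroup G := H.map φ with hH₂
  have hφapp : ∀ g : G, φ g = g ^ 2 := fun g => rfl
  -- (a) `G = H ∪ cH`
  have ha := mem_or_inv_mul_mem_of_natCard_quotient_le_two H hG hc
  -- (b) `H = H₂ ∪ c²H₂`
  have hc2H : c ^ 2 ∈ H := ⟨c, rfl⟩
  have hb : ∀ h ∈ H, h ∈ H₂ ∨ (c ^ 2)⁻¹ * h ∈ H₂ := by
    rintro h ⟨g, rfl⟩
    rcases ha g with hg | hg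
    · exact Or.inl ⟨g, hg, rfl⟩
    · right
      refine ⟨c⁻¹ * g, hg, ?_⟩
      rw [hφapp, hφapp, mul_pow, inv_pow]
  -- (c) squaring maps `H₂` onto itself, hence injectively
  have hH₂le : H₂ ≤ H := by
    rintro x ⟨h, -, rfl⟩
    exact ⟨h, rfl⟩
  have hc' : ∀ x ∈ H₂, ∃ y ∈ H₂, φ y = x := by
    rintro x ⟨h, hh, rfl⟩
    rcases hb h hh with h1 | h1
    · exact ⟨h, h1, rfl⟩
    · refine ⟨(c ^ 2)⁻¹ * h, h1, ?_⟩
      rw [hφapp, hφapp, mul_pow, inv_pow, ← pow_mul, show 2 * 2 = 4 by rfl, hc4, inv_one, one_mul]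
  let f : H₂ → H₂ := fun x => ⟨φ x.1, Subgroup.mem_map_of_mem φ (hH₂le x.2)⟩
  have hfs : Function.Surjective f := by
    rintro ⟨x, hx⟩
    obtain ⟨y, hy, hyx⟩ := hc' x hx
    exact ⟨⟨y, hy⟩, Subtype.ext hyx⟩
  have hfi : Function.Injective f := Finite.injective_iff_surjective.mpr hfs
  have hinj : ∀ x ∈ H₂, x ^ 2 = 1 → x = 1 := by
    intro x hx hx2
    have h1 : f ⟨x, hx⟩ = f ⟨1, H₂.one_mem⟩ := by
      apply Subtype.ext
      show φ x = φ 1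
      rw [hφapp, hφapp, hx2, one_pow]
    exact congrArg Subtype.val (hfi h1)
  -- (d) `#H₂` is odd
  have hodd : ¬ 2 ∣ Nat.card H₂ := by
    intro h2
    obtain ⟨x, hx⟩ := exists_prime_orderOf_dvd_card' 2 h2
    have hx2 : (x : G) ^ 2 = 1 := by
      rw [← Subgroup.coe_pow, ← hx, pow_orderOf_eq_one, Subgroup.coe_one]
    have hx1 : (x : G) = 1 := hinj x x.2 hx2
    have : x = 1 := Subtype.ext hx1
    rw [this, orderOf_one] at hx
    exact absurd hx (by norm_num)
  -- `#(H/H₂) ≤ 2`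
  set H₂' : Subgroup H := H₂.subgroupOf H with hH₂'
  have hidx : Nat.card (H ⧸ H₂') ≤ 2 := by
    refine natCard_le_two_of_forall_eq_or_eq (a := (1 : H ⧸ H₂'))
      (b := QuotientGroup.mk ⟨c ^ 2, hc2H⟩) fun x => ?_
    obtain ⟨h, rfl⟩ := QuotientGroup.mk_surjective x
    rcases hb h.1 h.2 with h1 | h1
    · left
      rw [QuotientGroup.eq_one_iff, hH₂', Subgroup.mem_subgroupOf]
      exact h1
    · right
      have h1' : (h : G)⁻¹ * c ^ 2 ∈ H₂ := by
        have := H₂.inv_mem h1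
        rwa [mul_inv_rev, inv_inv] at this
      rw [QuotientGroup.eq, hH₂', Subgroup.mem_subgroupOf]
      simpa using h1'
  -- counting
  have hcardG := Subgroup.card_eq_card_quotient_mul_card_subgroup H
  have hcardH := Subgroup.card_eq_card_quotient_mul_card_subgroup H₂'
  have hH₂card : Nat.card H₂' = Nat.card H₂ := Nat.card_congr (Subgroup.subgroupOfEquivOfLe hH₂le).toEquiv
  rw [hH₂card] at hcardH
  have hpos1 : 0 < Nat.card (G ⧸ H) := Nat.card_pos
  have hpos2 : 0 < Nat.card (H ⧸ H₂') := Nat.card_pos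
  have hoddm : Nat.card H₂ % 2 = 1 := by
    rcases Nat.mod_two_eq_zero_or_one (Nat.card H₂) with h | h
    · exact absurd (Nat.dvd_of_mod_eq_zero h) hodd
    · exact h
  intro h8
  rw [hcardG, hcardH] at h8
  set a := Nat.card (G ⧸ H)
  set b := Nat.card (H ⧸ H₂')
  set m := Nat.card H₂
  interval_cases a <;> interval_cases b <;> omega

/-- ★ **`ord₂ #G = 2`** when `4 ∣ #G`, `#(G/G²) ≤ 2`, and some `c` with `c⁴ = 1` is not a square.
[cite: Cohen1993, §4.1 (finite abelian groups)] [cite: NeukirchANT1999, Ch. I §3] -/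
theorem padicValNat_two_natCard_eq_two_of_not_mem_range_sq (hG : Nat.card (G ⧸ (powMonoidHom 2 : G →* G).range) ≤ 2)
    (h4 : 4 ∣ Nat.card G) {c : G} (hc4 : c ^ 4 = 1) (hc : c ∉ (powMonoidHom 2 : G →* G).range) :
    padicValNat 2 (Nat.card G) = 2 := by
  haveI : Fact (Nat.Prime 2) := ⟨Nat.prime_two⟩
  have h8 := not_eight_dvd_natCard_of_not_mem_range_sq hG hc4 hc
  have hpos : Nat.card G ≠ 0 := Nat.card_pos.ne'
  apply le_antisymm
  · by_contra hlt
    rw [not_le] at hlt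
    have : 2 ^ 3 ∣ Nat.card G := (padicValNat_dvd_iff_le hpos).mpr hlt
    exact h8 (by norm_num at this; exact this)
  · rw [show (4 : ℕ) = 2 ^ 2 by norm_num] at h4
    exact (padicValNat_dvd_iff_le hpos).mp h4

end Group

/-! ## §2 The relative norm of the certificate ideal: `N_{L/K}((q₀, v)) = (q₀)` -/

section Norms

variable {K L : Type} [Field K] [NumberField K] [Field L] [NumberField L] [Algebra K L]

/-- `(intNorm δ : K) = N_{L/K}(δ : L)` (Mathlib `Algebra.algebraMap_intNorm`). [folklore] -/
private theorem coe_intNorm_eq_norm' (δ : 𝓞 L) :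
    ((Algebra.intNorm (𝓞 K) (𝓞 L) δ : 𝓞 K) : K) = Algebra.norm K (δ : L) :=
  Algebra.algebraMap_intNorm (A := 𝓞 K) (K := K) (L := L) (B := 𝓞 L) δ

/-- `N_{L/K}(β) = β²` for `β ∈ 𝓞_K` and `[L : K] = 2`. [cite: NeukirchANT1999, Ch. I §2 Prop. (2.6)] -/
theorem intNorm_algebraMap_eq_sq (h2 : Module.finrank K L = 2) (β : 𝓞 K) :
    Algebra.intNorm (𝓞 K) (𝓞 L) (algebraMap (𝓞 K) (𝓞 L) β) = β ^ 2 := by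
  apply RingOfIntegers.coe_injective
  change ((Algebra.intNorm (𝓞 K) (𝓞 L) (algebraMap (𝓞 K) (𝓞 L) β) : 𝓞 K) : K) = ((β ^ 2 : 𝓞 K) : K)
  rw [coe_intNorm_eq_norm']
  have : ((algebraMap (𝓞 K) (𝓞 L) β : 𝓞 L) : L) = algebraMap K L (β : K) :=
    (IsScalarTower.algebraMap_apply (𝓞 K) (𝓞 L) L β).symm.trans (IsScalarTower.algebraMap_apply (𝓞 K) K L β)
  rw [this, Algebra.norm_algebraMap, h2]
  push_cast
  ring

/-- **`N_{L/K}(𝔅) = (q₀)`** for the certificate ideal: `𝔅² = (w, b²)`, `(w, b²)² = (w)`, `N_{L/K}(w) = u·q₀⁴` ⟹ `N(𝔅)⁴ = (q₀)⁴` ⟹ `N(𝔅) = (q₀)`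
(`I² = J² ⟹ I = J` twice). [cite: NeukirchANT1999, Ch. III §1 (1.6) (relative norm of ideals; `N((x)) = (N x)`)] -/
theorem relNorm_eq_span_of_orderFourCert {I : Ideal (𝓞 L)} {w b : 𝓞 L} {q₀ : 𝓞 K} {u : (𝓞 K)ˣ}
    (hI2 : I ^ 2 = Ideal.span {w, b ^ 2}) (hI4 : (Ideal.span {w, b ^ 2}) ^ 2 = Ideal.span {w})
    (hNw : Algebra.intNorm (𝓞 K) (𝓞 L) w = (u : 𝓞 K) * q₀ ^ 4) :
    Ideal.relNorm (𝓞 K) I = Ideal.span {q₀} := by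
  have h4 : (Ideal.relNorm (𝓞 K) I) ^ 4 = (Ideal.span {q₀}) ^ 4 := by
    rw [← map_pow, show I ^ 4 = (I ^ 2) ^ 2 by rw [← pow_mul], hI2, hI4, Ideal.relNorm_singleton, hNw,
      Ideal.span_singleton_pow]
    exact Ideal.span_singleton_eq_span_singleton.mpr (associated_unit_mul_left _ _ (Units.isUnit u))
  have h2' : (Ideal.relNorm (𝓞 K) I) ^ 2 = (Ideal.span {q₀}) ^ 2 := by
    apply Ideal.eq_of_sq_eq_sq
    rw [← pow_mul, ← pow_mul]
    exact h4
  exact Ideal.eq_of_sq_eq_sq h2'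

end Norms

/-! ## §3 The order-four class is not a square (genus bit `−1`); `ord₂ h_L = 2` -/

section Main

variable {K L : Type} [Field K] [NumberField K] [Field L] [NumberField L] [Algebra K L]

/-- ★★ **The class of an ideal of relative norm `(q₀)`, `q₀ ≡ ±3 (mod 𝔭₁³)`, is NOT A SQUARE in `Cl(L)`.**  `L/K` Galois quadratic, `s² = 2`, `s ∉ K`;
`h_K` odd; `𝔭₁` a non-zero prime of `𝓞_K` with residue field `𝔽₂`, `2 ∈ 𝔭₁ ∖ 𝔭₁²`; all units of `K` are `≡ ±1 (mod 𝔭₁³)`; `I` an ideal of `𝓞_L` with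
`N_{L/K}(I) = (q₀)`, `q₀ ≡ ±3 (mod 𝔭₁³)`.  If `[I] = [𝔅]²` then `(x)𝔅² = (y)I`, `N(x)N(𝔅)² = N(y)(q₀)`; with `N(𝔅)^h = (β)` (`h = h_K` odd):
`N(x^h β y^h) = u (N(y)^h)² q₀^h` — impossible by the genus character at `𝔭₁` (att-p3 g43's `intNorm_ne_unit_mul_sq_mul_pow`).
[cite: Gras2003, IV.4 (genus characters kill squares)] [cite: Serre1973CourseArithmetic, Ch. III §1.2, Thm. 1] [cite: NeukirchANT1999, Ch. III §1 (1.6)] -/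
theorem forall_sq_ne_mk0_of_relNorm_eq_of_genusBit [IsGalois K L] (h2 : Module.finrank K L = 2) {s : L} (hs : s ^ 2 = 2)
    (hsK : ∀ k : K, algebraMap K L k ≠ s) (hodd : Odd (classNumber K))
    (P : Ideal (𝓞 K)) [P.IsMaximal] (hP0 : P ≠ ⊥) (hres : ∀ r : 𝓞 K, r ∈ P ∨ r - 1 ∈ P)
    (h2P : (2 : 𝓞 K) ∈ P) (h2P' : (2 : 𝓞 K) ∉ P ^ 2)
    (hunits : ∀ u : (𝓞 K)ˣ, (u : 𝓞 K) - 1 ∈ P ^ 3 ∨ (u : 𝓞 K) + 1 ∈ P ^ 3)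
    {I : Ideal (𝓞 L)} (hI : I ∈ (Ideal (𝓞 L))⁰) {q₀ : 𝓞 K} (hNI : Ideal.relNorm (𝓞 K) I = Ideal.span {q₀})
    (hq : q₀ - 3 ∈ P ^ 3 ∨ q₀ + 3 ∈ P ^ 3) :
    ∀ d : ClassGroup (𝓞 L), d ^ 2 ≠ ClassGroup.mk0 ⟨I, hI⟩ := by
  classical
  intro d hd
  obtain ⟨B, rfl⟩ := ClassGroup.mk0_surjective d
  rw [← map_pow] at hd
  obtain ⟨x, y, hx, hy, hxy⟩ := ClassGroup.mk0_eq_mk0_iff.mp hd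
  simp only [SubmonoidClass.coe_pow] at hxy
  -- relative norms: `(Nx) N(B)² = (Ny) (q₀)`
  have hN := congrArg (Ideal.relNorm (𝓞 K)) hxy
  rw [map_mul, map_mul, map_pow, Ideal.relNorm_singleton, Ideal.relNorm_singleton, hNI] at hN
  -- `N(B)^h = (β)`
  have hB0 : Ideal.relNorm (𝓞 K) (B : Ideal (𝓞 L)) ≠ ⊥ := by
    rw [Ne, Ideal.relNorm_eq_bot_iff]; exact nonZeroDivisors.ne_zero B.2
  set NB : (Ideal (𝓞 K))⁰ := ⟨Ideal.relNorm (𝓞 K) (B : Ideal (𝓞 L)),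
    mem_nonZeroDivisors_of_ne_zero (by rwa [Ne, Ideal.zero_eq_bot])⟩ with hNB
  have hh : ClassGroup.mk0 (NB ^ classNumber K) = 1 := by
    rw [map_pow, classNumber]; exact pow_card_eq_one
  have hvalB : (NB ^ classNumber K : (Ideal (𝓞 K))⁰) = ⟨Ideal.relNorm (𝓞 K) (B : Ideal (𝓞 L)) ^ classNumber K,
      mem_nonZeroDivisors_of_ne_zero (pow_ne_zero _ (by rwa [Ne, Ideal.zero_eq_bot]))⟩ := by
    apply Subtype.ext; simp [hNB]
  rw [hvalB, ClassGroup.mk0_eq_one_iff] at hh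
  haveI := hh
  obtain ⟨β, hβ⟩ := Submodule.IsPrincipal.principal (Ideal.relNorm (𝓞 K) (B : Ideal (𝓞 L)) ^ classNumber K)
  rw [Ideal.submodule_span_eq] at hβ
  -- raise to the `h`-th power: `((Nx)^h β²) = ((Ny)^h q₀^h)`
  have hNh := congrArg (fun J : Ideal (𝓞 K) => J ^ classNumber K) hN
  rw [mul_pow, mul_pow, ← pow_mul, mul_comm 2, pow_mul, hβ, Ideal.span_singleton_pow, Ideal.span_singleton_pow,
    Ideal.span_singleton_pow, Ideal.span_singleton_pow, Ideal.span_singleton_mul_span_singleton,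
    Ideal.span_singleton_mul_span_singleton, Ideal.span_singleton_eq_span_singleton] at hNh
  obtain ⟨u, hu⟩ := hNh
  -- the element `δ = x^h · β · y^h` has norm `u⁻¹ ((Ny)^h)² q₀^h`
  have hy0 : Algebra.intNorm (𝓞 K) (𝓞 L) y ^ classNumber K ≠ 0 :=
    pow_ne_zero _ (by rw [Ne, Algebra.intNorm_eq_zero]; exact hy)
  refine intNorm_ne_unit_mul_sq_mul_pow h2 hs hsK P hP0 hres h2P h2P' hq
    (x ^ classNumber K * algebraMap (𝓞 K) (𝓞 L) β * y ^ classNumber K) hy0 (hunits u⁻¹) hodd ?_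
  rw [map_mul, map_mul, map_pow, map_pow, intNorm_algebraMap_eq_sq h2]
  have hu' := congrArg (fun z => z * ((u⁻¹ : (𝓞 K)ˣ) : 𝓞 K) * Algebra.intNorm (𝓞 K) (𝓞 L) y ^ classNumber K) hu
  rw [Units.mul_inv_cancel_right] at hu'
  linear_combination hu'

/-- ★★ **`ord₂ h_L = 2` from the order-four certificate with genus bit `−1`.**  If `4 ∣ h_L` (the order-four certificate), `#(Cl_L/Cl_L²) ≤ 2`, the
certificate ideal `𝔅` satisfies `𝔅² = (w, b²)`, `(w, b²)² = (w)`, `N(w) = u q₀⁴`, and `q₀ ≡ ±3 (mod 𝔭₁³)` (with the genus hypotheses on `K`, `𝔭₁`), then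
`[𝔅]⁴ = 1`, `[𝔅] ∉ Cl²`, so `8 ∤ h_L` and `ord₂ h_L = 2`. [cite: Gras2003, IV.4] [cite: NeukirchANT1999, Ch. I §7 Thm. (7.4), Ch. III §1 (1.6)] -/
theorem padicValNat_two_card_classGroup_eq_two_of_genusBit [IsGalois K L] (h2 : Module.finrank K L = 2) {s : L} (hs : s ^ 2 = 2)
    (hsK : ∀ k : K, algebraMap K L k ≠ s) (hodd : Odd (classNumber K))
    (P : Ideal (𝓞 K)) [P.IsMaximal] (hP0 : P ≠ ⊥) (hres : ∀ r : 𝓞 K, r ∈ P ∨ r - 1 ∈ P)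
    (h2P : (2 : 𝓞 K) ∈ P) (h2P' : (2 : 𝓞 K) ∉ P ^ 2)
    (hunits : ∀ u : (𝓞 K)ˣ, (u : 𝓞 K) - 1 ∈ P ^ 3 ∨ (u : 𝓞 K) + 1 ∈ P ^ 3)
    (hrank : Nat.card (ClassGroup (𝓞 L) ⧸ (powMonoidHom 2 : ClassGroup (𝓞 L) →* ClassGroup (𝓞 L)).range) ≤ 2)
    (h4 : 4 ∣ Nat.card (ClassGroup (𝓞 L)))
    {I : Ideal (𝓞 L)} {w b : 𝓞 L} {q₀ : 𝓞 K} {u : (𝓞 K)ˣ} (hb : b ≠ 0)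
    (hI2 : I ^ 2 = Ideal.span {w, b ^ 2}) (hI4 : (Ideal.span {w, b ^ 2}) ^ 2 = Ideal.span {w})
    (hNw : Algebra.intNorm (𝓞 K) (𝓞 L) w = (u : 𝓞 K) * q₀ ^ 4) (hq : q₀ - 3 ∈ P ^ 3 ∨ q₀ + 3 ∈ P ^ 3) :
    padicValNat 2 (Nat.card (ClassGroup (𝓞 L))) = 2 := by
  classical
  -- `I ≠ ⊥` (it contains `b²·…`? no: from `I² = (w, b²) ∋ b² ≠ 0`)
  have hI0 : I ≠ ⊥ := by
    intro h
    have hb2 : b ^ 2 ∈ Ideal.span {w, b ^ 2} := Ideal.subset_span (by simp)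
    rw [← hI2, h, ← Ideal.zero_eq_bot, zero_pow two_ne_zero, Ideal.zero_eq_bot, Submodule.mem_bot] at hb2
    exact hb (pow_eq_zero_iff two_ne_zero |>.mp hb2)
  have hImem : I ∈ (Ideal (𝓞 L))⁰ := mem_nonZeroDivisors_iff_ne_zero.mpr hI0
  set c := ClassGroup.mk0 ⟨I, hImem⟩ with hc
  have hJmem : Ideal.span {w, b ^ 2} ∈ (Ideal (𝓞 L))⁰ := by rw [← hI2]; exact pow_mem hImem 2
  have hwmem : Ideal.span {w} ∈ (Ideal (𝓞 L))⁰ := by rw [← hI4]; exact pow_mem hJmem 2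
  have hc4 : c ^ 4 = 1 := by
    have h22 : c ^ 4 = (c ^ 2) ^ 2 := by rw [← pow_mul]
    have hc2 : c ^ 2 = ClassGroup.mk0 ⟨Ideal.span {w, b ^ 2}, hJmem⟩ := by
      rw [hc, ← map_pow]; congr 1; exact Subtype.ext (by simp [hI2])
    rw [h22, hc2, ← map_pow]
    have heq : (⟨Ideal.span {w, b ^ 2}, hJmem⟩ : (Ideal (𝓞 L))⁰) ^ 2 = ⟨Ideal.span {w}, hwmem⟩ := Subtype.ext (by simp [hI4])
    rw [heq, ClassGroup.mk0_eq_one_iff]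
    exact ⟨⟨w, by rw [Ideal.submodule_span_eq]⟩⟩
  have hNI := relNorm_eq_span_of_orderFourCert hI2 hI4 hNw
  have hnsq := forall_sq_ne_mk0_of_relNorm_eq_of_genusBit h2 hs hsK hodd P hP0 hres h2P h2P' hunits hImem hNI hq
  have hc' : c ∉ (powMonoidHom 2 : ClassGroup (𝓞 L) →* ClassGroup (𝓞 L)).range := by
    rintro ⟨d, hd⟩
    exact hnsq d hd
  exact padicValNat_two_natCard_eq_two_of_not_mem_range_sq hrank h4 hc4 hc'

end Main

end Literature.NumberTheory.NumberFields

end
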